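import Summits.BirchSwinnertonDyer.BirchSwinnertonDyer.Theorems.SylvesterTwoHeegnerIndexCoupledTelescopeCebotarevKernelPair
import Summits.BirchSwinnertonDyer.BirchSwinnertonDyer.Theorems.SylvesterTwoHeegnerIndexCoupledDescentCebotarevSylvesterPair
import Literature.NumberTheory.EllipticCurves.JZeroTwoPowerTorsionMovingElement
import Literature.NumberTheory.EllipticCurves.HuShuYin2019.SylvesterPairNoFixedTwoPowerTorsion
import Literature.NumberTheory.EllipticCurves.SelmerTorsionOperatorLocalKernel
import Literature.NumberTheory.EllipticCurves.SelmerTorsionRestriction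
import HarnessLib

/-!
# The COUPLED Cassels–Tate telescope, XXIII: the (T-L3) conjunct of RESIDUE c v3 AT DISPLAY CURRENCY,
# with the rows' choices `Adm_X` (σ-eigenclasses) and `Kol` (Kolyvagin primes of the level)

Crux `UpperOffV0HSYPlus` (stmt-BirchSwinnertonDyer-19804), rows' display RESIDUE c v3 (`…TailFourOfResidue` p714972,
l.171–188 of `bsd-cm-k7t-c2/g28/RESIDUE-4.v3.display.txt`; twin `…TailSevenOfResidue`), clause (T-L3).  The sibling
`…CoupledTelescopeCebotarevKernelPair` proves it generically (`cebotarev_kernelForm_pair`); THIS file instantiates it on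
the display's objects — `A_K = (cubeSumCurve (3p²)).baseChange K`, `B_K = (cubeSumCurve p).baseChange K`, `K = ℚ(ω)`,
level `2^κ·2^κ`, the display's pinned CM data `(φ_X, fn_X, hfn_X)` with their formula / `hcoe` clauses — and FIXES the
two existential choices the assembler of `residueFour_holds` must make for this conjunct (planner D685):
* `Adm_X := {x | ∃ ε : ℤ, conjAct X c (2^κ·2^κ) x = ε • x}` (`c` = the conjugation of `K`, `c ω = ω²`): the
  σ-EIGENCLASSES.  Membership of the assembly's producers: `0` (`zero_mem_admSet`), restrictions from `ℚ`
  (`resTorsion_mem_admSet`, Gross 1991 (5.1) `res H¹(ℚ, ·) ⊆ H¹(K, ·)⁺` = the tree's `conjAct_resTorsion`), and the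
  Kolyvagin classes `c_X(n)` through Gross's Prop. 5.4 (`conjAct_kolyvaginClass_eq_smul`, to be fed by the (T-L1) leaf
  from its congruence `τ P_n ≡ ε P_n`; NOT discharged here).  For `Adm = univ` the clause is FALSE (a non-eigen
  `g = σ_* t ∉ 𝒪 t` fails the kernel form at every inert prime).
* `Kol ℓ := ℓ.Prime ∧ ℓ ∤ N_A ∧ ℓ ∤ N_B ∧ ℓ ∤ d_K ∧ ℓ ≠ 2 ∧ (ℓ) prime ∧ FrobEqFrobInfty E_{3p²} K (2^κ·2^κ) ℓ ∧
  FrobEqFrobInfty E_p K (2^κ·2^κ) ℓ ∧ b₀ < ℓ` — the Kolyvagin primes of the level above a free bound `b₀`; RESIDUE's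
  `hKol` clause (`Kol ℓ → ℓ.Prime ∧ (ℓ) prime`) is two projections (`kol_prime_and_isPrime`).
Inputs discharged here, per curve: `hrel` (#37 `JZero.torsion_hrel_of_formula` from the display's formula clause),
`hnofix` (#34 `HuShuYin2019.cubeSumCurve_geomTorsion_eq_zero_of_forall_smul_eq`), `hKer` (#35
`resH1Hom_id_mem_torsionLocalKer_of_hasLocalPointsMaps` on the pinned isogeny), the moved `2`-torsion point
(`exists_two_torsion_torsionMap_ne`: level-`2` `hsy_curve_package` transported into `X_K[2^κ·2^κ]`), the movers
(`hsy_exists_moving` + #37 `JZero.moving_lift`, Kummer independence `pow_three_add_a₆_ne_zero_of_mem_adjoin_*`), the lift of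
`c` (`RatClosure.isLiftOfAut_absGaloisTransport_of_isImaginaryQuadratic`).
★ `cebotarev_kernelForm_sylvesterPair` — RESIDUE (T-L3) with these `Adm_X`, `Kol`, binders in the display's order.
Theorem-only (no definition, no named fact); nothing asserted on 19804; no stub closed; X12.CMAtTwo NOT proved; BSD
not claimed for any curve.  Sources: McCallum 1991 §3, §5; Gross 1991 §5 (5.1), Prop. 5.4, §9; HSY 2019 §2.
-/

-- every Summits module is named `Summit.<Summit>.<Problem>…`: the duplicated component is by design
set_option linter.dupNamespace false
set_option autoImplicit false

noncomputable section

open scoped Classical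
open WeierstrassCurve NumberField IsDedekindDomain Field
open Literature.NumberTheory.EllipticCurves Literature.NumberTheory.GaloisRepresentations
  Literature.NumberTheory.EllipticCurves.HuShuYin2019

namespace Summit.BirchSwinnertonDyer.BirchSwinnertonDyer.Theorems.SylvesterTwoCoupledTelescope

open SylvesterTwoCoupledDescentCebotarev SylvesterTwoCoupledDescentF4Package

variable {K : Type} [Field K] [NumberField K]

/-! ## The admissible sets: membership of `0` and of the restrictions from `ℚ`; the `Kol` projections -/

/-- The conjugation of `K = ℚ(ω)` (`c ω = ω²`) is not the identity. [folklore] -/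
theorem conj_ne_one {ω : K} (hω : ω ^ 2 + ω + 1 = 0) {c : K ≃ₐ[ℚ] K} (hcω : c ω = ω ^ 2) : c ≠ 1 := by
  intro h
  rw [h, AlgEquiv.one_apply] at hcω
  have h3 : (3 : K) ≠ 0 := three_ne_zero
  have : ω * (ω - 1) = 0 := by linear_combination hcω.symm
  rcases mul_eq_zero.mp this with h0 | h1
  · apply h3; linear_combination 3 * hω - (3 * ω + 3) * h0
  · apply h3; linear_combination hω - (ω + 2) * h1

/-- `0 ∈ Adm_X` (`σ_* 0 = 0 = 0 • 0`). [folklore] -/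
theorem zero_mem_admSet (X : WeierstrassCurve ℚ) (c : K ≃ₐ[ℚ] K) (n : ℤ) :
    (0 : galH1Torsion (X.baseChange K) n) ∈
      {x : galH1Torsion (X.baseChange K) n | ∃ ε : ℤ, conjAct X c n x = ε • x} :=
  ⟨0, by rw [map_zero, zero_smul]⟩

/-- **`res (H¹(ℚ, X[n])) ⊆ Adm_X`** (Gross 1991 (5.1): restricted classes are `σ`-fixed; the tree's
`conjAct_resTorsion`, `K = ℚ(ω)` being Galois). [cite: GrossLMS1991, §5 (5.1)] -/
theorem resTorsion_mem_admSet {ω : K} (hω : ω ^ 2 + ω + 1 = 0) (h2 : Module.finrank ℚ K = 2)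
    {c : K ≃ₐ[ℚ] K} (hcω : c ω = ω ^ 2) (X : WeierstrassCurve ℚ) (n : ℤ) (u : galH1Torsion X n) :
    resTorsion X K n u ∈ {x : galH1Torsion (X.baseChange K) n | ∃ ε : ℤ, conjAct X c n x = ε • x} := by
  haveI := JZero.isGalois_of_sq_add_self_add_one hω h2
  exact ⟨1, by rw [one_smul]; exact conjAct_resTorsion K X n c h2 (conj_ne_one hω hcω) u⟩

omit [NumberField K] in
/-- RESIDUE's `hKol` clause for the rows' `Kol`: two projections. [folklore] -/
theorem kol_prime_and_isPrime {P₁ P₂ P₃ P₄ P₅ P₆ P₇ : Prop} {ℓ : ℕ}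
    (h : ℓ.Prime ∧ P₁ ∧ P₂ ∧ P₃ ∧ P₄ ∧ (Ideal.span {(ℓ : 𝓞 K)}).IsPrime ∧ P₅ ∧ P₆ ∧ P₇) :
    ℓ.Prime ∧ (Ideal.span {(ℓ : 𝓞 K)}).IsPrime :=
  ⟨h.1, h.2.2.2.2.2.1⟩

/-! ## A `2`-torsion point of `X_K[n]` moved by the lift of complex conjugation -/

/-- **Complex conjugation moves a `2`-torsion point of a `j = 0` short model**, inside `X_K[n]` for any even
`n`: for `X = ⟨0,0,0,0,b⟩/ℚ` with `∛(−b) ∉ K = ℚ(ζ)` and an involutive lift `τ` of the conjugation `c`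
(`c ζ = ζ²`), some `π ∈ X_K[n]` has `2 • π = 0` and `τ π ≠ π` (level `2`: `hsy_curve_package`'s point `e′` with
`τe′ + e′ ≠ 0`; then `X_K[2] ⊆ X_K[n]`). [cite: GrossLMS1991, §9 (Props. 9.1, 9.3)] -/
theorem exists_two_torsion_torsionMap_ne (X : WeierstrassCurve ℚ) [X.IsElliptic] (h1 : X.a₁ = 0)
    (h2 : X.a₂ = 0) (h3 : X.a₃ = 0) (h4 : X.a₄ = 0) {ζ : K} (hζ : IsPrimitiveRoot ζ 3) {c : K ≃ₐ[ℚ] K}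
    (hcζ : c ζ = ζ ^ 2) {τ : AlgebraicClosure K ≃+* AlgebraicClosure K} (hτ : IsLiftOfAut c τ)
    (hinv : ∀ x, τ (τ x) = x) (hX : ∀ t : K, t ^ 3 + algebraMap ℚ K X.a₆ ≠ 0) (n : ℕ) (hn : 2 ∣ n) :
    ∃ π : geomTorsion (X.baseChange K) (n : ℤ), (2 : ℤ) • π = 0 ∧ hτ.torsionMap X (n : ℤ) π ≠ π := by
  obtain ⟨φ, fn, hrel, hφ, hfn, hcoe⟩ := exists_cm_data (K := K) X h1 h2 h3 h4 hζ ((2 : ℕ) : ℤ)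
  obtain ⟨-, -, -, -, -, -, -, -, -, -, -, -, e', he'⟩ :=
    hsy_curve_package X h1 h2 h3 h4 hζ hcζ hτ hinv hX φ hrel hφ fn hfn hcoe
  have h2e₀ : ((2 : ℕ) : ℤ) • (e' : geomPoints (X.baseChange K)) = 0 :=
    (mem_geomTorsion_iff (X.baseChange K) ((2 : ℕ) : ℤ) _).mp e'.2
  have h2e : (2 : ℤ) • (e' : geomPoints (X.baseChange K)) = 0 := by exact_mod_cast h2e₀
  have h2e' : (2 : ℤ) • e' = 0 :=
    Subtype.ext (by rw [AddSubgroupClass.coe_zsmul, ZeroMemClass.coe_zero]; exact h2e)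
  have hne : hτ.torsionMap X ((2 : ℕ) : ℤ) e' ≠ e' := by
    intro h
    have h0 : hτ.torsionMap X ((2 : ℕ) : ℤ) e' + e' = 0 := by rw [h, ← two_zsmul, h2e']
    have := (he' 1 0 (by rw [h0, map_zero, smul_zero, smul_zero, add_zero])).1
    norm_num at this
  have hmem : (e' : geomPoints (X.baseChange K)) ∈ geomTorsion (X.baseChange K) (n : ℤ) := by
    obtain ⟨k, rfl⟩ := hn
    rw [mem_geomTorsion_iff, Nat.cast_mul, mul_comm, mul_smul, h2e₀, smul_zero]
  refine ⟨⟨e', hmem⟩, Subtype.ext ?_, fun h ↦ hne (Subtype.ext ?_)⟩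
  · rw [AddSubgroupClass.coe_zsmul, ZeroMemClass.coe_zero]; exact h2e
  · have h' := congrArg Subtype.val h
    rwa [IsLiftOfAut.coe_torsionMap] at h' ⊢

/-! ## The (T-L3) conjunct of RESIDUE c v3 at display currency -/

/-- ★ **RESIDUE c v3, clause (T-L3), for the rows' `Adm_X` and `Kol`.**  On the display's objects (`K = ℚ(ω)` quadratic,
`p ≡ 1 (mod 3)` prime, level `2^κ·2^κ`, `κ ≥ 1`, the pinned CM data of `A_K = E_{3p²,K}` and `B_K = E_{p,K}`), with
`Adm_X := {x | ∃ ε : ℤ, conjAct X c (2^κ·2^κ) x = ε • x}` and `Kol ℓ :=` «Kolyvagin prime of the level, `> b₀`»: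
for all finite `T_A ⊆ Adm_A`, `T_B ⊆ Adm_B`, `g_A ∈ Adm_A`, `g_B ∈ Adm_B` and every `b`, some `ℓ > b` with `Kol ℓ` at which
BOTH kernel forms hold (binders and conclusion in the display's order and spelling).  One call of
`cebotarev_kernelForm_pair` after discharging its per-curve inputs (module docstring).
[cite: McCallumLMS1991, §3 Prop. 3.1, (3); §5 Thm. 5.4] [cite: GrossLMS1991, §9 Props. 9.3, 9.6] -/
theorem cebotarev_kernelForm_sylvesterPair {ω : K} (hω : ω ^ 2 + ω + 1 = 0) (h2 : Module.finrank ℚ K = 2)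
    {p : ℕ} (hp : p.Prime) (hp3 : p % 3 = 1) {c : K ≃ₐ[ℚ] K} (hcω : c ω = ω ^ 2) (κ : ℕ) (hκ : 1 ≤ κ)
    (φA : Isogeny ((cubeSumCurve (3 * (p : ℚ) ^ 2)).baseChange K) ((cubeSumCurve (3 * (p : ℚ) ^ 2)).baseChange K))
    (fnA : geomTorsion ((cubeSumCurve (3 * (p : ℚ) ^ 2)).baseChange K) ((2 ^ κ * 2 ^ κ : ℕ) : ℤ) →+
      geomTorsion ((cubeSumCurve (3 * (p : ℚ) ^ 2)).baseChange K) ((2 ^ κ * 2 ^ κ : ℕ) : ℤ))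
    (hfnA : ∀ (g : absoluteGaloisGroup K)
      (Q : geomTorsion ((cubeSumCurve (3 * (p : ℚ) ^ 2)).baseChange K) ((2 ^ κ * 2 ^ κ : ℕ) : ℤ)),
      fnA (ContinuousMonoidHom.id _ g • Q) = g • fnA Q)
    (hφA : ∀ (x y : AlgebraicClosure K)
      (h : (((cubeSumCurve (3 * (p : ℚ) ^ 2)).baseChange K).baseChange (AlgebraicClosure K)).toAffine.Nonsingular x y),
      ∃ h', φA (Affine.Point.some x y h) =
        Affine.Point.some (algebraMap K (AlgebraicClosure K) ω ^ 2 * x) (algebraMap K (AlgebraicClosure K) ω ^ 3 * y) h')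
    (hcoeA : ∀ Q : geomTorsion ((cubeSumCurve (3 * (p : ℚ) ^ 2)).baseChange K) ((2 ^ κ * 2 ^ κ : ℕ) : ℤ),
      ((fnA Q : geomTorsion ((cubeSumCurve (3 * (p : ℚ) ^ 2)).baseChange K) ((2 ^ κ * 2 ^ κ : ℕ) : ℤ)) :
        geomPoints ((cubeSumCurve (3 * (p : ℚ) ^ 2)).baseChange K)) = φA Q)
    (φB : Isogeny ((cubeSumCurve (p : ℚ)).baseChange K) ((cubeSumCurve (p : ℚ)).baseChange K))
    (fnB : geomTorsion ((cubeSumCurve (p : ℚ)).baseChange K) ((2 ^ κ * 2 ^ κ : ℕ) : ℤ) →+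
      geomTorsion ((cubeSumCurve (p : ℚ)).baseChange K) ((2 ^ κ * 2 ^ κ : ℕ) : ℤ))
    (hfnB : ∀ (g : absoluteGaloisGroup K)
      (Q : geomTorsion ((cubeSumCurve (p : ℚ)).baseChange K) ((2 ^ κ * 2 ^ κ : ℕ) : ℤ)),
      fnB (ContinuousMonoidHom.id _ g • Q) = g • fnB Q)
    (hφB : ∀ (x y : AlgebraicClosure K)
      (h : (((cubeSumCurve (p : ℚ)).baseChange K).baseChange (AlgebraicClosure K)).toAffine.Nonsingular x y),
      ∃ h', φB (Affine.Point.some x y h) =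
        Affine.Point.some (algebraMap K (AlgebraicClosure K) ω ^ 2 * x) (algebraMap K (AlgebraicClosure K) ω ^ 3 * y) h')
    (hcoeB : ∀ Q : geomTorsion ((cubeSumCurve (p : ℚ)).baseChange K) ((2 ^ κ * 2 ^ κ : ℕ) : ℤ),
      ((fnB Q : geomTorsion ((cubeSumCurve (p : ℚ)).baseChange K) ((2 ^ κ * 2 ^ κ : ℕ) : ℤ)) :
        geomPoints ((cubeSumCurve (p : ℚ)).baseChange K)) = φB Q)
    {NA NB : ℕ} [NeZero NA] [NeZero NB] (b₀ : ℕ) :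
    ∀ (TA : Finset (galH1Torsion ((cubeSumCurve (3 * (p : ℚ) ^ 2)).baseChange K) ((2 ^ κ * 2 ^ κ : ℕ) : ℤ)))
      (TB : Finset (galH1Torsion ((cubeSumCurve (p : ℚ)).baseChange K) ((2 ^ κ * 2 ^ κ : ℕ) : ℤ)))
      (gA : galH1Torsion ((cubeSumCurve (3 * (p : ℚ) ^ 2)).baseChange K) ((2 ^ κ * 2 ^ κ : ℕ) : ℤ))
      (gB : galH1Torsion ((cubeSumCurve (p : ℚ)).baseChange K) ((2 ^ κ * 2 ^ κ : ℕ) : ℤ)),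
      gA ∈ {x : galH1Torsion ((cubeSumCurve (3 * (p : ℚ) ^ 2)).baseChange K) ((2 ^ κ * 2 ^ κ : ℕ) : ℤ) |
        ∃ ε : ℤ, conjAct (cubeSumCurve (3 * (p : ℚ) ^ 2)) c ((2 ^ κ * 2 ^ κ : ℕ) : ℤ) x = ε • x} →
      gB ∈ {x : galH1Torsion ((cubeSumCurve (p : ℚ)).baseChange K) ((2 ^ κ * 2 ^ κ : ℕ) : ℤ) |
        ∃ ε : ℤ, conjAct (cubeSumCurve (p : ℚ)) c ((2 ^ κ * 2 ^ κ : ℕ) : ℤ) x = ε • x} →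
      (↑TA : Set _) ⊆ {x : galH1Torsion ((cubeSumCurve (3 * (p : ℚ) ^ 2)).baseChange K) ((2 ^ κ * 2 ^ κ : ℕ) : ℤ) |
        ∃ ε : ℤ, conjAct (cubeSumCurve (3 * (p : ℚ) ^ 2)) c ((2 ^ κ * 2 ^ κ : ℕ) : ℤ) x = ε • x} →
      (↑TB : Set _) ⊆ {x : galH1Torsion ((cubeSumCurve (p : ℚ)).baseChange K) ((2 ^ κ * 2 ^ κ : ℕ) : ℤ) |
        ∃ ε : ℤ, conjAct (cubeSumCurve (p : ℚ)) c ((2 ^ κ * 2 ^ κ : ℕ) : ℤ) x = ε • x} → ∀ b : ℕ,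
      ∃ ℓ, b < ℓ ∧
        (ℓ.Prime ∧ ¬ ℓ ∣ NA ∧ ¬ ℓ ∣ NB ∧ ¬ ((ℓ : ℤ) ∣ NumberField.discr K) ∧ ℓ ≠ 2 ∧
          (Ideal.span {(ℓ : 𝓞 K)}).IsPrime ∧
          FrobEqFrobInfty (cubeSumCurve (3 * (p : ℚ) ^ 2)) K (2 ^ κ * 2 ^ κ) ℓ ∧
          FrobEqFrobInfty (cubeSumCurve (p : ℚ)) K (2 ^ κ * 2 ^ κ) ℓ ∧ b₀ < ℓ) ∧
      (∀ g ∈ AddSubgroup.closure (insert gA (insert (resH1Hom (ContinuousMonoidHom.id _) fnA hfnA gA)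
          ((TA : Set _) ∪ resH1Hom (ContinuousMonoidHom.id _) fnA hfnA '' (TA : Set _)))),
        (∀ v : HeightOneSpectrum (𝓞 K), (ℓ : 𝓞 K) ∈ v.asIdeal →
          g ∈ ((cubeSumCurve (3 * (p : ℚ) ^ 2)).baseChange K).torsionLocalKer (v.adicCompletion K)
            ((2 ^ κ * 2 ^ κ : ℕ) : ℤ)) ↔
        g ∈ AddSubgroup.closure ((TA : Set _) ∪ resH1Hom (ContinuousMonoidHom.id _) fnA hfnA '' (TA : Set _))) ∧
      (∀ g ∈ AddSubgroup.closure (insert gB (insert (resH1Hom (ContinuousMonoidHom.id _) fnB hfnB gB)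
          ((TB : Set _) ∪ resH1Hom (ContinuousMonoidHom.id _) fnB hfnB '' (TB : Set _)))),
        (∀ v : HeightOneSpectrum (𝓞 K), (ℓ : 𝓞 K) ∈ v.asIdeal →
          g ∈ ((cubeSumCurve (p : ℚ)).baseChange K).torsionLocalKer (v.adicCompletion K)
            ((2 ^ κ * 2 ^ κ : ℕ) : ℤ)) ↔
        g ∈ AddSubgroup.closure ((TB : Set _) ∪ resH1Hom (ContinuousMonoidHom.id _) fnB hfnB '' (TB : Set _))) := by
  intro TA TB gA gB hgA hgB hTA hTB b
  -- ### the curves, the field, the conjugation and its lift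
  have hp2 : p ≠ 2 := by rintro rfl; norm_num at hp3
  have hp0 : (p : ℚ) ≠ 0 := by exact_mod_cast hp.ne_zero
  haveI := Rank1Residual.X12.CubeSumFamilies.isElliptic_cubeSumCurve hp0
  haveI := Rank1Residual.X12.CubeSumFamilies.isElliptic_cubeSumCurve
    (mul_ne_zero (by norm_num) (pow_ne_zero 2 hp0) : (3 * (p : ℚ) ^ 2) ≠ 0)
  have hK : IsImaginaryQuadratic K := JZero.isImaginaryQuadratic_of_sq_add_self_add_one hω h2
  have hζ : IsPrimitiveRoot ω 3 := (JZero.exists_aut_apply_eq_sq K hω h2).1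
  have hc : c ≠ 1 := conj_ne_one hω hcω
  obtain ⟨c₀, hc₀⟩ := exists_isComplexConjugation (Rat.castHom ℝ)
  have ht : IsLiftOfAut c (absGaloisTransport (K := ℚ) (L := K) c₀).toRingEquiv :=
    RatClosure.isLiftOfAut_absGaloisTransport_of_isImaginaryQuadratic hK hc hc₀
  have hinv : ∀ x, (absGaloisTransport (K := ℚ) (L := K) c₀).toRingEquiv
      ((absGaloisTransport (K := ℚ) (L := K) c₀).toRingEquiv x) = x := fun x ↦
    RatClosure.absGaloisTransport_absGaloisTransport_of_sq_eq_one hc₀.sq_eq_one x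
  have hlev : 2 ^ κ * 2 ^ κ = 2 ^ (2 * κ) := by rw [two_mul, pow_add]
  have h2dvd : 2 ∣ 2 ^ κ * 2 ^ κ := (dvd_pow_self 2 (by omega)).mul_right _
  -- ### per-curve inputs of `cebotarev_kernelForm_pair`
  have hrelA : ∀ Q, fnA (fnA Q) + fnA Q + Q = 0 := JZero.torsion_hrel_of_formula
    (baseChange_eq_of_a_eq_zero (K := K) (cubeSumCurve (3 * (p : ℚ) ^ 2)) rfl rfl rfl rfl) hζ φA hφA _ fnA hcoeA
  have hrelB : ∀ Q, fnB (fnB Q) + fnB Q + Q = 0 := JZero.torsion_hrel_of_formula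
    (baseChange_eq_of_a_eq_zero (K := K) (cubeSumCurve (p : ℚ)) rfl rfl rfl rfl) hζ φB hφB _ fnB hcoeB
  have hnofixA : ∀ Q : geomTorsion ((cubeSumCurve (3 * (p : ℚ) ^ 2)).baseChange K) ((2 ^ κ * 2 ^ κ : ℕ) : ℤ),
      (∀ g : absoluteGaloisGroup K, g • Q = Q) → Q = 0 := fun Q hQ ↦
    cubeSumCurve_geomTorsion_eq_zero_of_forall_smul_eq hω h2
      ⟨3 * (p : ℤ) ^ 2, (by decide : Odd (3 : ℤ)).mul (by exact_mod_cast (hp.odd_of_ne_two hp2).pow),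
        by push_cast; rfl⟩ (m := 2 ^ κ * 2 ^ κ) (k := 2 * κ) hlev Q hQ
  have hnofixB : ∀ Q : geomTorsion ((cubeSumCurve (p : ℚ)).baseChange K) ((2 ^ κ * 2 ^ κ : ℕ) : ℤ),
      (∀ g : absoluteGaloisGroup K, g • Q = Q) → Q = 0 := fun Q hQ ↦
    cubeSumCurve_geomTorsion_eq_zero_of_forall_smul_eq hω h2
      ⟨p, by exact_mod_cast hp.odd_of_ne_two hp2, by push_cast; rfl⟩ (m := 2 ^ κ * 2 ^ κ) (k := 2 * κ) hlev Q hQ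
  have hKerA : ∀ v : HeightOneSpectrum (𝓞 K), ∀ x ∈ ((cubeSumCurve (3 * (p : ℚ) ^ 2)).baseChange K).torsionLocalKer
      (v.adicCompletion K) ((2 ^ κ * 2 ^ κ : ℕ) : ℤ), resH1Hom (ContinuousMonoidHom.id _) fnA hfnA x ∈
        ((cubeSumCurve (3 * (p : ℚ) ^ 2)).baseChange K).torsionLocalKer (v.adicCompletion K) ((2 ^ κ * 2 ^ κ : ℕ) : ℤ) :=
    fun v x hx ↦ resH1Hom_id_mem_torsionLocalKer_of_hasLocalPointsMaps _ (v.adicCompletion K) fnA hfnA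
      φA.toAddMonoidHom (fun Q ↦ hcoeA Q) φA.hasLocalPointsMaps_toAddMonoidHom hx
  have hKerB : ∀ v : HeightOneSpectrum (𝓞 K), ∀ x ∈ ((cubeSumCurve (p : ℚ)).baseChange K).torsionLocalKer
      (v.adicCompletion K) ((2 ^ κ * 2 ^ κ : ℕ) : ℤ), resH1Hom (ContinuousMonoidHom.id _) fnB hfnB x ∈
        ((cubeSumCurve (p : ℚ)).baseChange K).torsionLocalKer (v.adicCompletion K) ((2 ^ κ * 2 ^ κ : ℕ) : ℤ) :=
    fun v x hx ↦ resH1Hom_id_mem_torsionLocalKer_of_hasLocalPointsMaps _ (v.adicCompletion K) fnB hfnB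
      φB.toAddMonoidHom (fun Q ↦ hcoeB Q) φB.hasLocalPointsMaps_toAddMonoidHom hx
  have hπA := exists_two_torsion_torsionMap_ne (cubeSumCurve (3 * (p : ℚ) ^ 2)) rfl rfl rfl rfl hζ hcω ht hinv
    (forall_pow_three_add_algebraMap_a₆_three_mul_sq_ne_zero hω h2 hp hp2) (2 ^ κ * 2 ^ κ) h2dvd
  have hπB := exists_two_torsion_torsionMap_ne (cubeSumCurve (p : ℚ)) rfl rfl rfl rfl hζ hcω ht hinv
    (forall_pow_three_add_algebraMap_a₆_ne_zero_of_prime hω h2 hp hp2) (2 ^ κ * 2 ^ κ) h2dvd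
  -- ### the movers: level-`2` Kummer independence (HSY: `9/2` is not a cube), lifted to the level
  obtain ⟨φA₂, fnA₂, hA₂rel, hA₂φ, hA₂fn, hA₂coe⟩ :=
    exists_cm_data (K := K) (cubeSumCurve (3 * (p : ℚ) ^ 2)) rfl rfl rfl rfl hζ ((2 : ℕ) : ℤ)
  obtain ⟨φB₂, fnB₂, hB₂rel, hB₂φ, hB₂fn, hB₂coe⟩ :=
    exists_cm_data (K := K) (cubeSumCurve (p : ℚ)) rfl rfl rfl rfl hζ ((2 : ℕ) : ℤ)
  obtain ⟨zA, hzA, hzAsurj⟩ := hsy_exists_moving (cubeSumCurve (3 * (p : ℚ) ^ 2)) (cubeSumCurve (p : ℚ))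
    rfl rfl rfl rfl rfl rfl rfl rfl hζ (pow_three_add_a₆_ne_zero_of_mem_adjoin_of_prime hω h2 hp hp3)
    φA₂ hA₂rel hA₂φ fnA₂ hA₂coe
  obtain ⟨zB, hzB, hzBsurj⟩ := hsy_exists_moving (cubeSumCurve (p : ℚ)) (cubeSumCurve (3 * (p : ℚ) ^ 2))
    rfl rfl rfl rfl rfl rfl rfl rfl hζ (pow_three_add_a₆_ne_zero_of_mem_adjoin_of_three_mul_sq hω h2 hp hp3)
    φB₂ hB₂rel hB₂φ fnB₂ hB₂coe
  obtain ⟨hzA', hzA'bij⟩ := JZero.moving_lift ((cubeSumCurve (3 * (p : ℚ) ^ 2)).baseChange K)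
    ((cubeSumCurve (p : ℚ)).baseChange K) (2 ^ κ * 2 ^ κ) fnA (M := 2 * κ) hlev (by omega) hrelA
    (fun g Q ↦ hfnA g Q) zA hzA hzAsurj
  obtain ⟨hzB', hzB'bij⟩ := JZero.moving_lift ((cubeSumCurve (p : ℚ)).baseChange K)
    ((cubeSumCurve (3 * (p : ℚ) ^ 2)).baseChange K) (2 ^ κ * 2 ^ κ) fnB (M := 2 * κ) hlev (by omega) hrelB
    (fun g Q ↦ hfnB g Q) zB hzB hzBsurj
  -- ### the generic leaf
  obtain ⟨ℓ, hbℓ, hℓ, hℓA, hℓB, hℓd, hℓ2, hℓP, hFA, hFB, hKFA, hKFB⟩ :=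
    cebotarev_kernelForm_pair (NA := NA) (NB := NB) hK hc₀ ht hinv (2 ^ κ * 2 ^ κ) (M := 2 * κ) hlev (by omega)
      fnA hrelA hfnA hnofixA hKerA hπA fnB hrelB hfnB hnofixB hKerB hπB hzA' hzA'bij hzB' hzB'bij TA TB gA gB
      hgA hgB (fun t ht' ↦ hTA ht') (fun t ht' ↦ hTB ht') (max b b₀)
  exact ⟨ℓ, lt_of_le_of_lt (le_max_left _ _) hbℓ,
    ⟨hℓ, hℓA, hℓB, hℓd, hℓ2, hℓP, hFA, hFB, lt_of_le_of_lt (le_max_right _ _) hbℓ⟩, hKFA, hKFB⟩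

end Summit.BirchSwinnertonDyer.BirchSwinnertonDyer.Theorems.SylvesterTwoCoupledTelescope

end
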